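import Summits.Ventures.PercRepro.S1CoreCapAvg
import Summits.Ventures.PercRepro.S1CoreCapSpecSpreadFiveMain

/-!
# PercRepro — THE SPREAD `s₄` CHAIN: `s₄ ≤ 24` AT NULLITY `5`, AND THE `(14, 6)` CELL CAP `30` (p1, gen 32)

`proofs/P1-S2-CORANK6.md` §4c, §4g–§4h. The spread clause `¬h4` (no set of nullity `4` on `≤ 9` points) survives the deletion of a point
(`spread_delete`), so p3's deletion recursion runs inside the class of SPREAD e-free cores (`ncard_fourCircuits_le_sum_of_perPoint_hereditary`:
the recursion with a deletion-closed side condition) with the spread per-point bounds `qSpread = 0, 1, 4, 5, 6, 8, 9` (the kernel instances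
`fourCapSpecSpread_four / _five` here, `_six` in `S1CoreCapSpreadChainSix`, and `FourCapSpecSpread.of_fourCapSpec` on the plain instances below
`4`): **`s₄ ≤ Σ_{j ≤ d} Q j` on every spread e-free core of nullity `d` whenever the spread spec holds with `Q j` up to `d`**
(`ncard_fourCircuits_le_capSum_spread_of`), hence **`s₄ ≤ 24` at nullity `5`**. The averaging recursion with an explicit count of non-coloops,
inside the spread class (`ncard_fourCircuits_sub_div_le_of_nonColoops_spread`), then gives the first cell cap of §4c: **`s₄ ≤ 30` on a spread
coloop-free core of nullity `6` on `20` points (the `(14, 6)` cell)** — `s − ⌊4s/20⌋ ≤ 24 ⟹ s ≤ 30` — against the global cap `35`; the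
`(14, 7)` cap `40` is `S1CoreCapSpreadChainSix`. Nothing here closes a cell (§4c: the spread cases need the `s₅ / s₆` spread caps too).
Axioms: standard.
-/

open scoped Matroid

namespace PercRepro

namespace S1

open Set

open FourCap

variable {α : Type}

/-- **The spread clause survives deletion**: a set of `M ＼ {x}` has the rank it has in `M`. -/
theorem spread_delete (M : Matroid α) (hns : ¬ ∃ W ⊆ M.E, W.ncard ≤ 9 ∧ W.encard = M.eRk W + 4) (x : α) :
    ¬ ∃ W ⊆ (M ＼ {x}).E, W.ncard ≤ 9 ∧ W.encard = (M ＼ {x}).eRk W + 4 := by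
  rintro ⟨W, hW, h9, hW4⟩
  rw [_root_.Matroid.delete_ground] at hW
  refine hns ⟨W, hW.trans Set.sdiff_subset, h9, ?_⟩
  rw [_root_.Matroid.delete_eq_restrict, _root_.Matroid.restrict_eRk_eq M hW] at hW4
  exact hW4

/-- **The deletion recursion inside a deletion-closed class** `P` of e-free cores (p3's
`FourCircuitCap.ncard_fourCircuits_le_sum_of_perPoint` with the side condition threaded through): if every e-free core of nullity `j`
in the class has at most `q j` four-circuits through each point, an e-free core of nullity `d` in the class has at most `Σ_{j ≤ d} q j`. -/
theorem ncard_fourCircuits_le_sum_of_perPoint_hereditary (P : Matroid α → Prop)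
    (hP : ∀ (M : Matroid α) (x : α), P M → P (M ＼ {x})) (q : ℕ → ℕ)
    (hq : ∀ (M' : Matroid α) [M'.Finite],
      (∀ e ∈ M'.E, ∃ A ⊆ M'.E \ {e}, e ∉ M'.closure A ∧ e ∉ M'.closure ((M'.E \ {e}) \ A)) → P M' →
      ∀ j : ℕ, M'.E.encard = M'.eRank + j → ∀ e ∈ M'.E,
      {C : Set α | M'.IsCircuit C ∧ C.ncard = 4 ∧ e ∈ C}.ncard ≤ q j)
    (M : Matroid α) [M.Finite]
    (hfree : ∀ e ∈ M.E, ∃ A ⊆ M.E \ {e}, e ∉ M.closure A ∧ e ∉ M.closure ((M.E \ {e}) \ A)) (hPM : P M)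
    {d : ℕ} (hd : M.E.encard = M.eRank + d) :
    {C : Set α | M.IsCircuit C ∧ C.ncard = 4}.ncard ≤ (Finset.range (d + 1)).sum q := by
  suffices H : ∀ n : ℕ, ∀ (M : Matroid α) [M.Finite], M.E.ncard = n →
      (∀ e ∈ M.E, ∃ A ⊆ M.E \ {e}, e ∉ M.closure A ∧ e ∉ M.closure ((M.E \ {e}) \ A)) → P M →
      ∀ d : ℕ, M.E.encard = M.eRank + d →
      {C : Set α | M.IsCircuit C ∧ C.ncard = 4}.ncard ≤ (Finset.range (d + 1)).sum q from
    H _ M rfl hfree hPM d hd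
  intro n
  induction n using Nat.strong_induction_on with
  | _ n ih =>
  intro M _ hn hfree hPM d hd
  classical
  set S := {C : Set α | M.IsCircuit C ∧ C.ncard = 4} with hS
  by_cases hSe : S = ∅
  · rw [hSe, ncard_empty]; exact Nat.zero_le _
  obtain ⟨C₀, hC₀⟩ := nonempty_iff_ne_empty.2 hSe
  obtain ⟨e, heC₀⟩ := hC₀.1.nonempty
  have heE : e ∈ M.E := hC₀.1.subset_ground heC₀
  have hne : ¬ M.IsColoop e := hC₀.1.not_isColoop_of_mem heC₀
  have hν : M✶.eRank = (d : ℕ∞) := by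
    have h := _root_.Matroid.eRank_add_eRank_dual M
    rw [hd] at h
    exact WithTop.add_left_cancel (PercRepro.Matroid.eRank_ne_top_of_finite M) h
  have hdel := PercRepro.Matroid.dual_eRank_delete_singleton_add_one heE hne
  rw [hν] at hdel
  have hfin' : (M ＼ {e})✶.eRank ≠ ⊤ := by
    intro h
    rw [h] at hdel
    exact absurd hdel (by simp)
  obtain ⟨d', hd'⟩ := ENat.ne_top_iff_exists.1 hfin'
  have hdd' : d = d' + 1 := by
    rw [← hd'] at hdel
    exact_mod_cast hdel.symm
  have hd'enc : (M ＼ {e}).E.encard = (M ＼ {e}).eRank + d' := by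
    have h := _root_.Matroid.eRank_add_eRank_dual (M ＼ {e})
    rw [← hd'] at h
    exact h.symm
  have hdelE : (M ＼ {e}).E.ncard < n := by
    rw [_root_.Matroid.delete_ground, ← hn, ← ncard_sdiff_singleton_add_one heE M.ground_finite]
    omega
  have hfree' := S1.hfree_delete M hfree e
  have hsplit := S1.ncard_fourCircuits_le_through_add_delete M e
  rw [← hS] at hsplit
  have h1 := hq M hfree hPM d hd e heE
  have h2 := ih _ hdelE (M ＼ {e}) rfl hfree' (hP M e hPM) d' hd'enc
  subst hdd'
  rw [Finset.sum_range_succ]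
  have h2' : {C : Set α | (M ＼ {e}).IsCircuit C ∧ C.ncard = 4}.ncard ≤ ∑ x ∈ Finset.range (d' + 1), q x := h2
  omega

/-- **The spread per-point table** `Q*_spread(0 … 6) = 0, 1, 4, 5, 6, 8, 9`, `perPointBound` beyond. -/
def qSpread (j : ℕ) : ℕ :=
  if j = 0 then 0 else if j = 1 then 1 else if j = 2 then 4 else if j = 3 then 5 else if j = 4 then 6 else if j = 5 then 8
    else if j = 6 then 9 else perPointBound j

/-- `Σ_{j ≤ 5} qSpread j = 24`. -/
theorem capSum_qSpread_five : capSum qSpread 5 = 24 := by decide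

/-- `Σ_{j ≤ 6} qSpread j = 33` (used by `S1CoreCapSpreadChainSix`). -/
theorem capSum_qSpread_six : capSum qSpread 6 = 33 := by decide

/-- **The kernel instances of the spread spec up to nullity `5`**: `0, 1, 4, 5` from the plain instances, `6, 8` from
`fourCapSpecSpread_four / _five`. -/
theorem fourCapSpecSpread_qSpread_five : ∀ j ≤ 5, FourCapSpecSpread capPaper j (qSpread j) := by
  intro j hj
  interval_cases j
  · exact FourCapSpecSpread.of_fourCapSpec fourCapSpec_zero
  · exact FourCapSpecSpread.of_fourCapSpec fourCapSpec_one
  · exact FourCapSpecSpread.of_fourCapSpec fourCapSpec_two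
  · exact FourCapSpecSpread.of_fourCapSpec fourCapSpec_three
  · exact fourCapSpecSpread_four
  · exact fourCapSpecSpread_five

/-- **`s₄ ≤ Σ_{j ≤ d} Q j` on every spread e-free core of nullity `d`** whenever `FourCapSpecSpread capPaper j (Q j)` holds for every
`j ≤ d` (the recursion inside the spread class with the spread bridge as the per-point bound). -/
theorem ncard_fourCircuits_le_capSum_spread_of (M : Matroid α) [M.Finite]
    (hfree : ∀ e ∈ M.E, ∃ A ⊆ M.E \ {e}, e ∉ M.closure A ∧ e ∉ M.closure ((M.E \ {e}) \ A))
    (hns : ¬ ∃ W ⊆ M.E, W.ncard ≤ 9 ∧ W.encard = M.eRk W + 4)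
    {d : ℕ} (hd : M.E.encard = M.eRank + d) (Q : ℕ → ℕ) (hQ : ∀ j ≤ d, FourCapSpecSpread capPaper j (Q j)) :
    {C : Set α | M.IsCircuit C ∧ C.ncard = 4}.ncard ≤ capSum Q d := by
  classical
  let q : ℕ → ℕ := fun j => if j ≤ d then Q j else perPointBound j
  have hq : ∀ (M' : Matroid α) [M'.Finite],
      (∀ e ∈ M'.E, ∃ A ⊆ M'.E \ {e}, e ∉ M'.closure A ∧ e ∉ M'.closure ((M'.E \ {e}) \ A)) →
      (¬ ∃ W ⊆ M'.E, W.ncard ≤ 9 ∧ W.encard = M'.eRk W + 4) →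
      ∀ j : ℕ, M'.E.encard = M'.eRank + j → ∀ e ∈ M'.E,
      {C : Set α | M'.IsCircuit C ∧ C.ncard = 4 ∧ e ∈ C}.ncard ≤ q j := by
    intro M' _ hfree' hns' j hj e he
    by_cases hjd : j ≤ d
    · simp only [q, hjd, if_true]
      exact ncard_fourCircuitsThrough_le_of_fourCapSpecSpread M' hfree' hj hns' he (hQ j hjd)
    · simp only [q, hjd, if_false]
      exact ncard_fourCircuitsThrough_le_perPointBound M' hfree' hj e
  have h := ncard_fourCircuits_le_sum_of_perPoint_hereditary
    (fun M' : Matroid α => ¬ ∃ W ⊆ M'.E, W.ncard ≤ 9 ∧ W.encard = M'.eRk W + 4)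
    (fun M' x h => spread_delete M' h x) q hq M hfree hns hd
  refine h.trans (le_of_eq ?_)
  unfold capSum
  refine Finset.sum_congr rfl (fun j hj => ?_)
  have : j ≤ d := Nat.lt_succ_iff.1 (Finset.mem_range.1 hj)
  simp only [q, this, if_true]

/-- **`s₄ ≤ 24` on every spread e-free core of nullity `5`.** -/
theorem ncard_fourCircuits_le_twenty_four_spread (M : Matroid α) [M.Finite]
    (hfree : ∀ e ∈ M.E, ∃ A ⊆ M.E \ {e}, e ∉ M.closure A ∧ e ∉ M.closure ((M.E \ {e}) \ A))
    (hns : ¬ ∃ W ⊆ M.E, W.ncard ≤ 9 ∧ W.encard = M.eRk W + 4) (hd : M.E.encard = M.eRank + 5) :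
    {C : Set α | M.IsCircuit C ∧ C.ncard = 4}.ncard ≤ 24 := by
  have := ncard_fourCircuits_le_capSum_spread_of M hfree hns (d := 5) (by exact_mod_cast hd) qSpread fourCapSpecSpread_qSpread_five
  rwa [capSum_qSpread_five] at this

open Classical in
/-- **The averaging recursion with an explicit count of non-coloops, inside the spread class**: on a spread core of nullity `d + 1`
with at least `m ≥ 1` non-coloops, if every SPREAD core of nullity `d` has `s₄ ≤ B`, then `s₄ − ⌊4·s₄/m⌋ ≤ B` (the deletion at a
non-coloop stays spread, `spread_delete`). -/
theorem ncard_fourCircuits_sub_div_le_of_nonColoops_spread (M : Matroid α) [M.Finite]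
    (hfree : ∀ e ∈ M.E, ∃ A ⊆ M.E \ {e}, e ∉ M.closure A ∧ e ∉ M.closure ((M.E \ {e}) \ A))
    (hns : ¬ ∃ W ⊆ M.E, W.ncard ≤ 9 ∧ W.encard = M.eRk W + 4)
    {d : ℕ} (hd : M.E.encard = M.eRank + (d + 1)) {m : ℕ} (hm0 : 0 < m)
    (hm : m ≤ (M.E \ M.coloops).ncard) {B : ℕ}
    (hB : ∀ (M' : Matroid α) [M'.Finite],
      (∀ e ∈ M'.E, ∃ A ⊆ M'.E \ {e}, e ∉ M'.closure A ∧ e ∉ M'.closure ((M'.E \ {e}) \ A)) →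
      (¬ ∃ W ⊆ M'.E, W.ncard ≤ 9 ∧ W.encard = M'.eRk W + 4) →
      M'.E.encard = M'.eRank + d → {C : Set α | M'.IsCircuit C ∧ C.ncard = 4}.ncard ≤ B) :
    {C : Set α | M.IsCircuit C ∧ C.ncard = 4}.ncard -
      4 * {C : Set α | M.IsCircuit C ∧ C.ncard = 4}.ncard / m ≤ B := by
  rcases Nat.eq_zero_or_pos {C : Set α | M.IsCircuit C ∧ C.ncard = 4}.ncard with h0 | hpos
  · rw [h0]; simp
  obtain ⟨x, hxE, hxc, hx⟩ := exists_nonColoop_ncard_fourCircuitsThrough_le M hpos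
  have hm' : m ≤ (M.ground_finite.toFinset.filter (fun x => ¬ M.IsColoop x)).card := by
    have : (M.ground_finite.toFinset.filter (fun x => ¬ M.IsColoop x) : Set α) = M.E \ M.coloops := by
      ext y; simp only [Finset.coe_filter, Set.Finite.mem_toFinset, mem_setOf_eq, mem_sdiff,
        Matroid.isColoop_iff_mem_coloops]
    rw [← ncard_coe_finset, this]
    exact hm
  have hx' : {C : Set α | M.IsCircuit C ∧ C.ncard = 4 ∧ x ∈ C}.ncard ≤
      4 * {C : Set α | M.IsCircuit C ∧ C.ncard = 4}.ncard / m :=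
    hx.trans (Nat.div_le_div_left hm' hm0)
  have hν : M✶.eRank = ((d + 1 : ℕ) : ℕ∞) := by
    have h := _root_.Matroid.eRank_add_eRank_dual M
    rw [hd] at h
    exact WithTop.add_left_cancel (PercRepro.Matroid.eRank_ne_top_of_finite M) h
  have hdel := PercRepro.Matroid.dual_eRank_delete_singleton_add_one hxE hxc
  rw [hν] at hdel
  have hfin' : (M ＼ {x})✶.eRank ≠ ⊤ := by
    intro h
    rw [h] at hdel
    have h2 : ((d + 1 : ℕ) : ℕ∞) = ⊤ := by rw [← hdel]; simp
    exact ENat.coe_ne_top _ h2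
  obtain ⟨d', hd'⟩ := ENat.ne_top_iff_exists.1 hfin'
  have hdd' : d = d' := by
    rw [← hd'] at hdel
    have : d' + 1 = d + 1 := by exact_mod_cast hdel
    omega
  subst hdd'
  have hd'enc : (M ＼ {x}).E.encard = (M ＼ {x}).eRank + d := by
    have h := _root_.Matroid.eRank_add_eRank_dual (M ＼ {x})
    rw [← hd'] at h
    exact h.symm
  have hB' := hB (M ＼ {x}) (hfree_delete M hfree x) (spread_delete M hns x) hd'enc
  have hsplit := ncard_fourCircuits_le_through_add_delete M x
  omega

/-- **THE `(14, 6)` SPREAD CAP: `s₄ ≤ 30`** on a spread coloop-free e-free core of nullity `6` on `20` points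
(`s − ⌊4s/20⌋ ≤ 24`; the global cap was `35`). -/
theorem ncard_fourCircuits_le_thirty_spread_twenty (M : Matroid α) [M.Finite]
    (hfree : ∀ e ∈ M.E, ∃ A ⊆ M.E \ {e}, e ∉ M.closure A ∧ e ∉ M.closure ((M.E \ {e}) \ A))
    (hns : ¬ ∃ W ⊆ M.E, W.ncard ≤ 9 ∧ W.encard = M.eRk W + 4) (hd : M.E.encard = M.eRank + 6)
    (hn : M.E.ncard = 20) (hK : ∀ e, ¬ M.IsColoop e) :
    {C : Set α | M.IsCircuit C ∧ C.ncard = 4}.ncard ≤ 30 := by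
  have hcol : M.coloops = ∅ := S2.coloops_eq_empty_of_forall_not M hK
  have hm : 20 ≤ (M.E \ M.coloops).ncard := by rw [hcol, Set.sdiff_empty, hn]
  have h := ncard_fourCircuits_sub_div_le_of_nonColoops_spread M hfree hns (d := 5) (by rw [hd]; norm_num) (by norm_num) hm
    (B := 24) (fun M' _ hfree' hns' hd'' => ncard_fourCircuits_le_twenty_four_spread M' hfree' hns' (by rw [hd'']; norm_num))
  have := le_mul_div_of_sub_div_le (by norm_num : 4 < 20) h
  omega

end S1

end PercRepro
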